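import Literature.NumberTheory.Transcendental.KaehlerHodgeSmoothProofs
import Literature.NumberTheory.Transcendental.ComplexFormsSmoothProofs
import HarnessLib

/-!
# `∂̄*` of a smooth form is smooth: the corrected named fact (and why the original is not dischargeable)

Trunk **T-KAEHLER** (`NumberTheory/Transcendental`). Companion of
`Literature/NumberTheory/Transcendental/KaehlerHodge.lean`, §*Generic smoothness statements*, for
its named fact `Literature.NumberTheory.Transcendental.isSmoothForm_dolbeaultBarAdjoint` ("`∂̄*` of
a smooth form is smooth (holomorphic atlas, smooth metric)", Huybrechts, *Complex Geometry*
(2005), Def. 3.1.3 / §3.2).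

## Main statements (all proved)

* `Literature.NumberTheory.Transcendental.isSmoothForm_dolbeaultBarAdjoint_of_isContMDiffRiemannianBundle`
  (named fact, the **corrected statement** of `isSmoothForm_dolbeaultBarAdjoint`: a closed
  proposition binding the intended instances — holomorphic atlas, `C^∞` real atlas, `C^∞` metric
  on the real tangent bundle) and its discharge
  `isSmoothForm_dolbeaultBarAdjoint_of_isContMDiffRiemannianBundle_holds`, in the format of
  `Literature.Geometry.Kaehler.isSmoothForm_hodgeStar_of_isContMDiffRiemannianBundle[_holds]`
  (`RiemannianHodgeSmoothProofs.lean`) and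
  `Literature.NumberTheory.Transcendental.isSmoothForm_cHodgeStar_of_isContMDiffRiemannianBundle[_holds]`
  (`KaehlerHodgeSmoothProofs.lean`).

The usable dot-notation theorems (`IsSmoothForm.dolbeaultBarAdjoint` etc.) and the bridges to the
facts as declared belong to the sibling companion `KaehlerHodgeAdjointSmoothProofs.lean`; this
file keeps its two proof steps `private` so as not to pre-empt those names.

## Source

D. Huybrechts, *Complex Geometry. An Introduction* (2005). §3.1, Def. 3.1.1 (p. 114): an
hermitian structure on a complex manifold `X` is a Riemannian metric `g` compatible with the
almost complex structure — a Riemannian metric being a (smooth) section inducing a scalar product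
on each `T_xM` (Appendix A, p. 281 ff., where also "using the metric and the orientation one
introduces the Hodge `*`-operator `* : 𝒜ᵏ(M) → 𝒜^{m-k}(M)`"). §3.1, p. 115: `*` "is induced by
the metric `g` and the natural orientation" and is "extended `ℂ`-linearly to the complexified
bundles"; Def. 3.1.3: "If `(X, g)` is an hermitian manifold, then `∂* := -* ∘ ∂̄ ∘ *` and
`∂̄* = -* ∘ ∂ ∘ *`", operators `𝒜^{p,q}(X) → 𝒜^{p-1,q}(X)`, resp. `𝒜^{p,q-1}(X)`, on *smooth*
forms; §3.2, Lemma 3.2.3 (p. 126): on a compact hermitian manifold these are the formal adjoints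
of `∂`, `∂̄`. The smoothness content is Warner (1983), 4.10 (6), p. 150 ("`*` takes smooth forms
to smooth forms", for a `C^∞` metric), composed with smoothness of `∂`
(`Literature.NumberTheory.Transcendental.isSmoothForm_dolbeault`, Huybrechts Def. 2.6.9:
`∂ := Π^{p+1,q} ∘ d`).

## The fact as declared is mis-stated (not dischargeable)

`def isSmoothForm_dolbeaultBarAdjoint` of `KaehlerHodge.lean` sits in a section with the instance
variables `[IsManifold 𝓘(ℂ, E) ω M] [IsManifold 𝓘(ℝ, E) ∞ M]
[IsContinuousRiemannianBundle E (TangentSpace 𝓘(ℝ, E))]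
[IsContMDiffRiemannianBundle 𝓘(ℝ, E) ∞ E (TangentSpace 𝓘(ℝ, E))]`, but its body does not mention
them, and a `def` abstracts only the section variables it uses: `#check
@isSmoothForm_dolbeaultBarAdjoint` lists `[Bundle.RiemannianBundle fun x ↦ TangentSpace 𝓘(ℝ, E) x]`
— a fibrewise family of inner products with *no regularity in the base point* — as the only
hypothesis on the metric, and no compatibility hypothesis on the atlas (the same defect as
`isSmoothForm_cHodgeStar`, see `KaehlerHodgeSmoothProofs.lean`, and as
`Literature.Geometry.Kaehler.isSmoothForm_hodgeStar`, refuted as stated in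
`Literature/Geometry/Kaehler/RiemannianHodgeRoughMetric.lean`). For rough metrics the statement is
false: on `M = E = ℂ` (`n = 2`, `k = 0`, `m = 1`) take `g = diag(a, a⁻¹)` in the real basis
`(1, i)` with `a = 1` on `{Re z < 0}` and `a = 4` on `{Re z ≥ 0}`. Its volume form is the constant
`dx ∧ dy` (so the hypothesis `ho` holds) and `α = z dx` is smooth, while `⋆α = (z/a) dy`; on each
open half-plane `∂⋆α = a⁻¹ (∂z/∂z) dx ∧ dy` and `⋆(dx ∧ dy) = 1`, so `∂̄*α = -⋆∂⋆α = -a⁻¹` equals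
`-1` on `{Re z < 0}` and `-1/4` on `{Re z > 0}`: not continuous across the imaginary axis, whatever
junk values `mextDeriv` produces on the axis itself. Hence `isSmoothForm_dolbeaultBarAdjoint_holds`
can never be proved; following D-0014 the original def is left untouched (it has no dependents)
and the corrected statement is vendored here under a new name. The hermitian (compatibility)
condition on `g` and `IsContinuousRiemannianBundle` play no role for smoothness and are not
assumed.

## Proof

`⋆_ℂ` of a smooth form is smooth (`Literature.Geometry.Kaehler.IsSmoothForm.cHodgeStar`,
`KaehlerHodgeSmoothProofs.lean`, from G21's proved `IsSmoothForm.hodgeStar`); `∂` of a smooth form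
is smooth (`isSmoothForm_dolbeault` fed the discharged facts `isSmoothForm_typeComponent_holds` —
this is where the holomorphic atlas enters — and `isSmoothForm_mextDeriv (inChart_mextDeriv_holds
𝓘(ℝ, E) M ℂ)`); and `∂̄*α = (-1) • ⋆(∂(⋆α))` (`IsSmoothForm.smul_complex`). This is the interim
proof preserved (commented) under the fact in `KaehlerHodge.lean`, run under the instances it
silently required.

## References

* D. Huybrechts, *Complex Geometry. An Introduction*, Universitext, Springer (2005), §2.6,
  Def. 2.6.9; §3.1, Def. 3.1.1 (p. 114), p. 115, Def. 3.1.3; §3.2, Lemma 3.2.3 (p. 126);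
  Appendix A, p. 281 ff.
* F. W. Warner, *Foundations of Differentiable Manifolds and Lie Groups*, GTM 94, Springer (1983),
  4.10 (6), p. 150; 6.1, p. 220.
* P. Griffiths, J. Harris, *Principles of Algebraic Geometry* (1978), p. 82.
-/

noncomputable section

open scoped Manifold ContDiff
open Bundle Module

namespace Literature.NumberTheory.Transcendental

open Literature.Geometry.Kaehler

section Steps

variable {E : Type*} [NormedAddCommGroup E] [NormedSpace ℂ E]
  {M : Type*} [TopologicalSpace M] [ChartedSpace E M] {k m : ℕ}
  [IsManifold 𝓘(ℂ, E) ω M] [IsManifold 𝓘(ℝ, E) ∞ M]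

/-- `∂` of a smooth complex form is smooth on a complex manifold:
`Literature.NumberTheory.Transcendental.isSmoothForm_dolbeault` fed the discharged facts
`isSmoothForm_typeComponent_holds` and `isSmoothForm_mextDeriv (inChart_mextDeriv_holds …)`
(private step; Huybrechts (2005), Def. 2.6.9). [cite: Huybrechts2005, Def. 2.6.9] -/
private theorem dolbeault_smooth_step {α : MForm 𝓘(ℝ, E) M ℂ k} (hα : IsSmoothForm α) :
    IsSmoothForm (dolbeault α) :=
  isSmoothForm_dolbeault (fun {_} ↦ isSmoothForm_typeComponent_holds)
    (fun {_ _} hβ ↦ isSmoothForm_mextDeriv (inChart_mextDeriv_holds 𝓘(ℝ, E) M ℂ) hβ) hα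

variable [FiniteDimensional ℂ E] {n : ℕ} [Fact (finrank ℝ E = n)]
  [RiemannianBundle (fun x : M ↦ TangentSpace 𝓘(ℝ, E) x)]
  [IsContMDiffRiemannianBundle 𝓘(ℝ, E) ∞ E (fun x : M ↦ TangentSpace 𝓘(ℝ, E) x)]
  (o : (x : M) → Orientation ℝ (TangentSpace 𝓘(ℝ, E) x) (Fin n))

/-- `∂̄*α = -⋆∂⋆α` of a smooth form is smooth (holomorphic atlas, `C^∞` metric, orientation
family with smooth volume form): composite of `IsSmoothForm.cHodgeStar`, `dolbeault_smooth_step`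
and a sign (private step; Huybrechts (2005), Def. 3.1.3). [cite: Huybrechts2005, Def. 3.1.3] -/
private theorem dolbeaultBarAdjoint_smooth_step (ho : IsSmoothForm (riemannianVolumeForm o))
    (h : (k + 1) + m = n) {α : MForm 𝓘(ℝ, E) M ℂ (k + 1)} (hα : IsSmoothForm α) :
    IsSmoothForm (dolbeaultBarAdjoint o h α) := by
  have h1 := (IsSmoothForm.cHodgeStar o ho (show (m + 1) + k = n by omega)
    (dolbeault_smooth_step (IsSmoothForm.cHodgeStar o ho h hα))).smul_complex (-1)
  rwa [neg_one_smul] at h1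

end Steps

/-! ### The corrected named fact -/

/-- **Corrected statement of the named fact
`Literature.NumberTheory.Transcendental.isSmoothForm_dolbeaultBarAdjoint`** (`KaehlerHodge.lean`).
On a complex manifold `M` (holomorphic atlas, modelled on the finite-dimensional complex normed
space `E`, with its `C^∞` real atlas) carrying a *smooth* Riemannian metric on the real tangent
bundle and an orientation family `o` with smooth volume form, `∂̄*α = -⋆∂⋆α` is smooth for every
smooth complex `(k+1)`-form `α` (`h : (k + 1) + m = n`, `n = dim_ℝ E`). Huybrechts (2005),
Def. 3.1.3: on an hermitian manifold `(X, g)` — `g` a Riemannian metric, i.e. a smooth section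
(Appendix A, p. 281), compatible with the complex structure (Def. 3.1.1, p. 114) —
"`∂̄* = -* ∘ ∂ ∘ *`" is an operator `𝒜^{p,q}(X) → 𝒜^{p,q-1}(X)` on smooth forms (§3.2,
Lemma 3.2.3: the formal adjoint of `∂̄` on a compact hermitian manifold); the compatibility
(hermitian) condition plays no role for smoothness and is not assumed here.

Discrepancy with the original: the `def isSmoothForm_dolbeaultBarAdjoint` of `KaehlerHodge.lean`
is declared in a section whose instance variables `[IsManifold 𝓘(ℂ, E) ω M]`,
`[IsManifold 𝓘(ℝ, E) ∞ M]`, `[IsContinuousRiemannianBundle E (TangentSpace 𝓘(ℝ, E))]`,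
`[IsContMDiffRiemannianBundle 𝓘(ℝ, E) ∞ E (TangentSpace 𝓘(ℝ, E))]` are *not used in its body*,
hence are not part of the definition: as declared it asserts smoothness of `∂̄*α` for *every*
fibrewise family of inner products (`Bundle.RiemannianBundle`, no regularity in the base point)
and every atlas, which is false (rough metric `diag(a, a⁻¹)` on `ℂ` with `a ∈ {1, 4}` jumping
across the imaginary axis: `∂̄*(z dx) = -a⁻¹` off the axis; see the module docstring). Here the
intended hypotheses are bound *inside* a closed statement (`IsContinuousRiemannianBundle` is not
needed); it is discharged by
`isSmoothForm_dolbeaultBarAdjoint_of_isContMDiffRiemannianBundle_holds`.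
[cite: Huybrechts2005, Def. 3.1.3; §3.2 Lemma 3.2.3] -/
def isSmoothForm_dolbeaultBarAdjoint_of_isContMDiffRiemannianBundle : Prop :=
  ∀ {E : Type*} [NormedAddCommGroup E] [NormedSpace ℂ E] [FiniteDimensional ℂ E] {n : ℕ}
    [Fact (finrank ℝ E = n)] {M : Type*} [TopologicalSpace M] [ChartedSpace E M]
    [IsManifold 𝓘(ℂ, E) ω M] [IsManifold 𝓘(ℝ, E) ∞ M]
    [RiemannianBundle (fun x : M ↦ TangentSpace 𝓘(ℝ, E) x)]
    [IsContMDiffRiemannianBundle 𝓘(ℝ, E) ∞ E (fun x : M ↦ TangentSpace 𝓘(ℝ, E) x)] {k m : ℕ}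
    (o : (x : M) → Orientation ℝ (TangentSpace 𝓘(ℝ, E) x) (Fin n)),
    IsSmoothForm (riemannianVolumeForm o) → ∀ (h : (k + 1) + m = n)
      {α : MForm 𝓘(ℝ, E) M ℂ (k + 1)}, IsSmoothForm α → IsSmoothForm (dolbeaultBarAdjoint o h α)

/-- **Discharge** of `isSmoothForm_dolbeaultBarAdjoint_of_isContMDiffRiemannianBundle` (the
corrected form of the named fact `isSmoothForm_dolbeaultBarAdjoint`): the composite
`-⋆ ∘ ∂ ∘ ⋆` of operators preserving smoothness (`IsSmoothForm.cHodgeStar`, Warner (1983),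
4.10 (6), p. 150; `isSmoothForm_dolbeault`). Huybrechts (2005), Def. 3.1.3.
[cite: Huybrechts2005, Def. 3.1.3; §3.2 Lemma 3.2.3] -/
theorem isSmoothForm_dolbeaultBarAdjoint_of_isContMDiffRiemannianBundle_holds :
    isSmoothForm_dolbeaultBarAdjoint_of_isContMDiffRiemannianBundle :=
  fun o ho h _ hα ↦ dolbeaultBarAdjoint_smooth_step o ho h hα

end Literature.NumberTheory.Transcendental
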